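import Mathlib.Topology.Connected.Clopen
import Mathlib.Analysis.Convex.StdSimplex
import Mathlib.Algebra.Homology.HomologicalComplexBiprod
import Mathlib.Algebra.Category.ModuleCat.Biproducts
import Literature.AlgebraicTopology.SingularHomology.SingularChainsConcrete
import Literature.AlgebraicTopology.SingularHomology.SingularCochains
import Literature.AlgebraicTopology.SingularHomology.ChainSubcomplex
import HarnessLib

/-!
# Additivity of singular (co)homology for disjoint unions (trunk G04 AlgTop)

For topological spaces `X`, `Y` and their topological sum `X ⊕ Y`:

* every singular simplex of `X ⊕ Y` factors through exactly one of the summands (the standard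
  simplex is connected and `Sum.inl`, `Sum.inr` are open embeddings with complementary images),
  `Literature.AlgebraicTopology.SingularHomology.SingularSimplex.range_subset_inl_or_inr`, with the lifts `liftInl`, `liftInr`;
* hence `(c₁, c₂) ↦ inl♯ c₁ + inr♯ c₂` is a bijection on chains and the chain map
  `biprod.desc inl♯ inr♯ : C(X) ⊞ C(Y) ⟶ C(X ⊕ Y)` is an isomorphism of complexes
  (`Literature.AlgebraicTopology.SingularHomology.csingularChainComplex.isIso_sumDesc`), and dually for cochains;
* **additivity**: `Hₙ(X; M) × Hₙ(Y; M) ≃ₗ[R] Hₙ(X ⊕ Y; M)`, `(a, b) ↦ inl_* a + inr_* b`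
  (`Literature.AlgebraicTopology.SingularHomology.singularHomology.sumEquiv`), and `Hⁿ(X ⊕ Y; M) ≃ₗ[R] Hⁿ(X; M) × Hⁿ(Y; M)`,
  `z ↦ (inl^* z, inr^* z)` (`Literature.AlgebraicTopology.SingularHomology.singularCohomology.sumEquiv`)
  (A. Hatcher, *Algebraic Topology* (2002), Prop. 2.6 / §2.3 axiom (4) "additivity":
  `Hₙ(∐ X_α) ≅ ⊕ Hₙ(X_α)`; §3.1 p. 202: `Hⁿ(∐ X_α; G) ≅ ∏ Hⁿ(X_α; G)`), here for two summands.

Everything is proved; nothing is asserted (D-0014).  Mathlib (pinned) has none of this for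
singular (co)homology (searched `singularHomology` + `Sum`, `biprod`); we use its `Sum.isConnected_iff`,
the path-connectedness of `stdSimplex` (`Mathlib.Analysis.Convex.StdSimplex`), binary biproducts of complexes
(`HomologicalComplex.biprodXIso`) and of modules (`ModuleCat.biprodIsoProd`), and the additivity of
the homology functor.

## References

* A. Hatcher, *Algebraic Topology*, CUP 2002, Prop. 2.6, §2.3 (axioms for homology, additivity),
  §3.1 p. 202. [Hatcher2002]
-/

noncomputable section

-- as in `SingularChainsConcrete`: chains of the concrete complex are `Finsupp`s up to unfolding
set_option backward.isDefEq.respectTransparency false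

open CategoryTheory Limits Topology

universe u v w t

namespace Literature.AlgebraicTopology.SingularHomology

/-! ### Elements of binary biproducts of complexes of modules -/

section Biprod

variable {S : Type v} [CommRing S] {β : Type t} {c : ComplexShape β}

/-- Two elements of a degree of a binary biproduct of complexes of modules with the same two
projections are equal (companion to `Literature.AlgebraicTopology.SingularHomology.biprod_decomp` of `ChainSubcomplex.lean`). [folklore] -/
lemma biprodX_ext {A B : HomologicalComplex (ModuleCat.{w} S) c} {i : β} {y y' : (A ⊞ B).X i}
    (h₁ : (biprod.fst : A ⊞ B ⟶ A).f i y = (biprod.fst : A ⊞ B ⟶ A).f i y')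
    (h₂ : (biprod.snd : A ⊞ B ⟶ B).f i y = (biprod.snd : A ⊞ B ⟶ B).f i y') : y = y' := by
  rw [← biprod_decomp i y, ← biprod_decomp i y', h₁, h₂]

end Biprod

variable (R : Type v) [CommRing R] (M : Type v) [AddCommGroup M] [Module R M]
variable {X Y : Type u} [TopologicalSpace X] [TopologicalSpace Y]

/-! ### Simplices of a disjoint union -/

namespace SingularSimplex

variable {n : ℕ}

variable (X Y) in
/-- The inclusion `X → X ⊕ Y` as a continuous map. [folklore] -/
abbrev sumInl : C(X, X ⊕ Y) := ⟨Sum.inl, continuous_inl⟩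

variable (X Y) in
/-- The inclusion `Y → X ⊕ Y` as a continuous map. [folklore] -/
abbrev sumInr : C(Y, X ⊕ Y) := ⟨Sum.inr, continuous_inr⟩

/-- **A singular simplex of `X ⊕ Y` lies in one summand**: its image (the continuous image of the
connected standard simplex) is contained in `X` or in `Y` (Hatcher 2002, Prop. 2.6: "a singular
simplex always has path-connected image"). [cite: Hatcher2002, Prop. 2.6] -/
theorem range_subset_inl_or_inr (σ : SingularSimplex (X ⊕ Y) n) :
    σ.range ⊆ Set.range Sum.inl ∨ σ.range ⊆ Set.range Sum.inr := by
  have hc : IsPreconnected σ.range := isPreconnected_range (toContinuousMap σ).continuous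
  rcases Sum.isPreconnected_iff.1 hc with ⟨t, -, ht⟩ | ⟨t, -, ht⟩
  · exact Or.inl (ht ▸ Set.image_subset_range _ _)
  · exact Or.inr (ht ▸ Set.image_subset_range _ _)

/-- A simplex of `X ⊕ Y` with image in `X` does not have image in `Y`. [folklore] -/
lemma not_range_subset_inr {σ : SingularSimplex (X ⊕ Y) n} (h : σ.range ⊆ Set.range Sum.inl) :
    ¬ σ.range ⊆ Set.range Sum.inr := by
  intro h'
  obtain ⟨z, hz⟩ := σ.range_nonempty
  obtain ⟨x, hx⟩ := h hz
  obtain ⟨y, hy⟩ := h' hz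
  exact Sum.inl_ne_inr (hx.trans hy.symm)

/-- The lift to `X` of a simplex of `X ⊕ Y` with image in `X` (through the embedding `Sum.inl`). [folklore] -/
def liftInl (σ : SingularSimplex (X ⊕ Y) n) (h : σ.range ⊆ Set.range Sum.inl) : SingularSimplex X n :=
  toContinuousMap.symm
    (((IsEmbedding.inl (X := X) (Y := Y)).toHomeomorph.symm :
        C(Set.range (Sum.inl : X → X ⊕ Y), X)).comp
      ⟨Set.codRestrict (toContinuousMap σ) _ fun t => h ⟨t, rfl⟩,
        (toContinuousMap σ).continuous.codRestrict _⟩)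

/-- The lift to `Y` of a simplex of `X ⊕ Y` with image in `Y` (through the embedding `Sum.inr`). [folklore] -/
def liftInr (σ : SingularSimplex (X ⊕ Y) n) (h : σ.range ⊆ Set.range Sum.inr) : SingularSimplex Y n :=
  toContinuousMap.symm
    (((IsEmbedding.inr (X := X) (Y := Y)).toHomeomorph.symm :
        C(Set.range (Sum.inr : Y → X ⊕ Y), Y)).comp
      ⟨Set.codRestrict (toContinuousMap σ) _ fun t => h ⟨t, rfl⟩,
        (toContinuousMap σ).continuous.codRestrict _⟩)

/-- `inl ∘ liftInl σ = σ`. [folklore] -/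
@[simp]
lemma liftInl_map (σ : SingularSimplex (X ⊕ Y) n) (h : σ.range ⊆ Set.range Sum.inl) :
    (σ.liftInl h).map (sumInl X Y) = σ := by
  apply toContinuousMap_injective
  rw [toContinuousMap_map, liftInl, Equiv.apply_symm_apply]
  ext t
  have e := (IsEmbedding.inl (X := X) (Y := Y)).toHomeomorph.apply_symm_apply
    ⟨toContinuousMap σ t, h ⟨t, rfl⟩⟩
  exact congrArg Subtype.val e

/-- `inr ∘ liftInr σ = σ`. [folklore] -/
@[simp]
lemma liftInr_map (σ : SingularSimplex (X ⊕ Y) n) (h : σ.range ⊆ Set.range Sum.inr) :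
    (σ.liftInr h).map (sumInr X Y) = σ := by
  apply toContinuousMap_injective
  rw [toContinuousMap_map, liftInr, Equiv.apply_symm_apply]
  ext t
  have e := (IsEmbedding.inr (X := X) (Y := Y)).toHomeomorph.apply_symm_apply
    ⟨toContinuousMap σ t, h ⟨t, rfl⟩⟩
  exact congrArg Subtype.val e

/-- A simplex of `X`, pushed into `X ⊕ Y`, has image in `X`. [folklore] -/
lemma range_map_inl (τ : SingularSimplex X n) : (τ.map (sumInl X Y)).range ⊆ Set.range Sum.inl := by
  rw [range_map]
  rintro _ ⟨x, -, rfl⟩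
  exact ⟨x, rfl⟩

/-- A simplex of `Y`, pushed into `X ⊕ Y`, has image in `Y`. [folklore] -/
lemma range_map_inr (τ : SingularSimplex Y n) : (τ.map (sumInr X Y)).range ⊆ Set.range Sum.inr := by
  rw [range_map]
  rintro _ ⟨y, -, rfl⟩
  exact ⟨y, rfl⟩

/-- `liftInl (inl ∘ τ) = τ`. [folklore] -/
@[simp]
lemma liftInl_map_inl (τ : SingularSimplex X n) (h : (τ.map (sumInl X Y)).range ⊆ Set.range Sum.inl) :
    (τ.map (sumInl X Y)).liftInl h = τ :=
  map_injective Sum.inl_injective (liftInl_map _ h)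

/-- `liftInr (inr ∘ τ) = τ`. [folklore] -/
@[simp]
lemma liftInr_map_inr (τ : SingularSimplex Y n) (h : (τ.map (sumInr X Y)).range ⊆ Set.range Sum.inr) :
    (τ.map (sumInr X Y)).liftInr h = τ :=
  map_injective Sum.inr_injective (liftInr_map _ h)

/-- Every simplex of `X ⊕ Y` is `inl ∘ τ` or `inr ∘ τ` (Hatcher 2002, Prop. 2.6). [cite: Hatcher2002, Prop. 2.6] -/
theorem exists_eq_map_inl_or_inr (σ : SingularSimplex (X ⊕ Y) n) :
    (∃ τ : SingularSimplex X n, τ.map (sumInl X Y) = σ) ∨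
      ∃ τ : SingularSimplex Y n, τ.map (sumInr X Y) = σ := by
  rcases σ.range_subset_inl_or_inr with h | h
  · exact Or.inl ⟨σ.liftInl h, σ.liftInl_map h⟩
  · exact Or.inr ⟨σ.liftInr h, σ.liftInr_map h⟩

/-- A simplex through `X` is not a simplex through `Y`. [folklore] -/
lemma map_inl_ne_map_inr (τ : SingularSimplex X n) (τ' : SingularSimplex Y n) :
    τ.map (sumInl X Y) ≠ τ'.map (sumInr X Y) := fun e =>
  not_range_subset_inr (range_map_inl τ) (e ▸ range_map_inr τ')

end SingularSimplex

/-! ### Chains of a disjoint union -/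

namespace csingularChainComplex

open SingularSimplex

variable {R M} {n : ℕ}

/-- The chain map `(c₁, c₂) ↦ inl♯ c₁ + inr♯ c₂ : C(X) ⊞ C(Y) ⟶ C(X ⊕ Y)` (Hatcher 2002,
Prop. 2.6, the map `⊕_α Hₙ(X_α) → Hₙ(X)` induced by the inclusions, at chain level). [cite: Hatcher2002, Prop. 2.6] -/
def sumDesc (R : Type v) [CommRing R] (M : Type v) [AddCommGroup M] [Module R M]
    (X Y : Type u) [TopologicalSpace X] [TopologicalSpace Y] :
    csingularChainComplex R M X ⊞ csingularChainComplex R M Y ⟶ csingularChainComplex R M (X ⊕ Y) :=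
  biprod.desc (csingularChainComplex.map R M (sumInl X Y)) (csingularChainComplex.map R M (sumInr X Y))

/-- The linear map `(c₁, c₂) ↦ inl♯ c₁ + inr♯ c₂` on `n`-chains. [folklore] -/
def sumChainMap (n : ℕ) : CChain M X n × CChain M Y n →ₗ[R] CChain M (X ⊕ Y) n :=
  (Finsupp.lmapDomain M R fun τ : SingularSimplex X n => τ.map (sumInl X Y)).coprod
    (Finsupp.lmapDomain M R fun τ : SingularSimplex Y n => τ.map (sumInr X Y))

/-- `sumChainMap (c₁, c₂) = inl♯ c₁ + inr♯ c₂`. [folklore] -/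
lemma sumChainMap_apply (c : CChain M X n × CChain M Y n) :
    sumChainMap (R := R) n c =
      Finsupp.mapDomain (fun τ : SingularSimplex X n => τ.map (sumInl X Y)) c.1 +
        Finsupp.mapDomain (fun τ : SingularSimplex Y n => τ.map (sumInr X Y)) c.2 := rfl

/-- Evaluating `inl♯ c₁ + inr♯ c₂` at `inl ∘ τ` gives `c₁ τ`. [folklore] -/
lemma sumChainMap_apply_map_inl (c : CChain M X n × CChain M Y n) (τ : SingularSimplex X n) :
    sumChainMap (R := R) n c (τ.map (sumInl X Y)) = c.1 τ := by
  rw [sumChainMap_apply, Finsupp.add_apply,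
    Finsupp.mapDomain_apply (map_injective Sum.inl_injective),
    Finsupp.mapDomain_notin_range, add_zero]
  rintro ⟨τ', e⟩
  exact map_inl_ne_map_inr τ τ' e.symm

/-- Evaluating `inl♯ c₁ + inr♯ c₂` at `inr ∘ τ` gives `c₂ τ`. [folklore] -/
lemma sumChainMap_apply_map_inr (c : CChain M X n × CChain M Y n) (τ : SingularSimplex Y n) :
    sumChainMap (R := R) n c (τ.map (sumInr X Y)) = c.2 τ := by
  rw [sumChainMap_apply, Finsupp.add_apply, Finsupp.mapDomain_notin_range,
    Finsupp.mapDomain_apply (map_injective Sum.inr_injective), zero_add]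
  rintro ⟨τ', e⟩
  exact map_inl_ne_map_inr τ' τ e

/-- **`(c₁, c₂) ↦ inl♯ c₁ + inr♯ c₂` is injective** on chains. [folklore] -/
theorem sumChainMap_injective : Function.Injective (sumChainMap (R := R) (M := M) (X := X) (Y := Y) n) := by
  intro c c' e
  refine Prod.ext (Finsupp.ext fun τ => ?_) (Finsupp.ext fun τ => ?_)
  · rw [← sumChainMap_apply_map_inl (R := R) c τ, ← sumChainMap_apply_map_inl (R := R) c' τ, e]
  · rw [← sumChainMap_apply_map_inr (R := R) c τ, ← sumChainMap_apply_map_inr (R := R) c' τ, e]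

/-- **`(c₁, c₂) ↦ inl♯ c₁ + inr♯ c₂` is surjective** on chains: every chain of `X ⊕ Y` is the sum of
a chain in `X` and a chain in `Y` (Hatcher 2002, Prop. 2.6: "`Cₙ(X)` splits as the direct sum of
its subgroups `Cₙ(X_α)`"). [cite: Hatcher2002, Prop. 2.6] -/
theorem sumChainMap_surjective :
    Function.Surjective (sumChainMap (R := R) (M := M) (X := X) (Y := Y) n) := by
  intro c
  rw [← LinearMap.mem_range, ← Finsupp.sum_single c, Finsupp.sum]
  refine Submodule.sum_mem _ fun σ _ => ?_
  rcases σ.exists_eq_map_inl_or_inr with ⟨τ, rfl⟩ | ⟨τ, rfl⟩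
  · exact ⟨(Finsupp.single τ (c (τ.map (sumInl X Y))), 0), by
      rw [sumChainMap_apply, Finsupp.mapDomain_single, Finsupp.mapDomain_zero, add_zero]⟩
  · exact ⟨(0, Finsupp.single τ (c (τ.map (sumInr X Y)))), by
      rw [sumChainMap_apply, Finsupp.mapDomain_zero, Finsupp.mapDomain_single, zero_add]⟩

end csingularChainComplex

namespace csingularChainComplex

open SingularSimplex

variable {R M} {n : ℕ}

/-- `biprod.desc inl♯ inr♯` restricted to the first summand is `inl♯`. [folklore] -/
lemma sumDesc_f_inl (a : (csingularChainComplex R M X).X n) :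
    (sumDesc R M X Y).f n
        ((biprod.inl : csingularChainComplex R M X ⟶
          csingularChainComplex R M X ⊞ csingularChainComplex R M Y).f n a) =
      (csingularChainComplex.map R M (sumInl X Y)).f n a := by
  rw [← ModuleCat.comp_apply, ← HomologicalComplex.comp_f, sumDesc, biprod.inl_desc]

/-- `biprod.desc inl♯ inr♯` restricted to the second summand is `inr♯`. [folklore] -/
lemma sumDesc_f_inr (b : (csingularChainComplex R M Y).X n) :
    (sumDesc R M X Y).f n
        ((biprod.inr : csingularChainComplex R M Y ⟶
          csingularChainComplex R M X ⊞ csingularChainComplex R M Y).f n b) =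
      (csingularChainComplex.map R M (sumInr X Y)).f n b := by
  rw [← ModuleCat.comp_apply, ← HomologicalComplex.comp_f, sumDesc, biprod.inr_desc]

/-- The chain map `biprod.desc inl♯ inr♯` in degree `n` is `(c₁, c₂) ↦ inl♯ c₁ + inr♯ c₂` on the
components. [folklore] -/
lemma sumDesc_f_apply (y : (csingularChainComplex R M X ⊞ csingularChainComplex R M Y).X n) :
    (sumDesc R M X Y).f n y =
      sumChainMap (R := R) n
        ((biprod.fst : csingularChainComplex R M X ⊞ csingularChainComplex R M Y ⟶ _).f n y,
          (biprod.snd : csingularChainComplex R M X ⊞ csingularChainComplex R M Y ⟶ _).f n y) := by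
  conv_lhs => rw [← biprod_decomp n y]
  rw [map_add, sumDesc_f_inl, sumDesc_f_inr]
  rfl

/-- **`biprod.desc inl♯ inr♯ : C(X) ⊞ C(Y) ⟶ C(X ⊕ Y)` is bijective in each degree.** [folklore] -/
theorem sumDesc_f_bijective (n : ℕ) : Function.Bijective ((sumDesc R M X Y).f n) := by
  constructor
  · intro y y' e
    rw [sumDesc_f_apply, sumDesc_f_apply] at e
    have e' := sumChainMap_injective e
    rw [Prod.mk.injEq] at e'
    rw [← biprod_decomp n y, ← biprod_decomp n y', e'.1, e'.2]
  · intro c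
    obtain ⟨⟨a, b⟩, rfl⟩ := sumChainMap_surjective (R := R) c
    refine ⟨(biprod.inl : csingularChainComplex R M X ⟶ _).f n a +
      (biprod.inr : csingularChainComplex R M Y ⟶ _).f n b, ?_⟩
    rw [map_add, sumDesc_f_inl, sumDesc_f_inr]
    rfl

/-- **`C(X) ⊞ C(Y) ≅ C(X ⊕ Y)`** as chain complexes, by `biprod.desc inl♯ inr♯`
(Hatcher 2002, Prop. 2.6). [cite: Hatcher2002, Prop. 2.6] -/
instance isIso_sumDesc : IsIso (sumDesc R M X Y) := by
  haveI : ∀ n, IsIso ((sumDesc R M X Y).f n) := fun n =>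
    (ConcreteCategory.isIso_iff_bijective _).2 (sumDesc_f_bijective n)
  exact HomologicalComplex.Hom.isIso_of_components _

variable (R M X Y) in
/-- The isomorphism of complexes `C(X) ⊞ C(Y) ≅ C(X ⊕ Y)` (Hatcher 2002, Prop. 2.6). [cite: Hatcher2002, Prop. 2.6] -/
def sumIso : csingularChainComplex R M X ⊞ csingularChainComplex R M Y ≅ csingularChainComplex R M (X ⊕ Y) :=
  asIso (sumDesc R M X Y)

/-- `inl ≫ sumIso = inl♯`. [folklore] -/
@[reassoc (attr := simp)]
lemma inl_sumIso_hom : biprod.inl ≫ (sumIso R M X Y).hom = csingularChainComplex.map R M (sumInl X Y) :=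
  biprod.inl_desc _ _

/-- `inr ≫ sumIso = inr♯`. [folklore] -/
@[reassoc (attr := simp)]
lemma inr_sumIso_hom : biprod.inr ≫ (sumIso R M X Y).hom = csingularChainComplex.map R M (sumInr X Y) :=
  biprod.inr_desc _ _

end csingularChainComplex

/-! ### Additivity of homology -/

namespace csingularHomology

open SingularSimplex

variable {R M}

/-- The projection `Hₙ(X ⊕ Y) → Hₙ(X)` of the concrete model (through `C(X ⊕ Y) ≅ C(X) ⊞ C(Y)`). [folklore] -/
def sumFst (n : ℕ) : csingularHomology R M (X ⊕ Y) n ⟶ csingularHomology R M X n :=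
  HomologicalComplex.homologyMap ((csingularChainComplex.sumIso R M X Y).inv ≫ biprod.fst) n

/-- The projection `Hₙ(X ⊕ Y) → Hₙ(Y)` of the concrete model. [folklore] -/
def sumSnd (n : ℕ) : csingularHomology R M (X ⊕ Y) n ⟶ csingularHomology R M Y n :=
  HomologicalComplex.homologyMap ((csingularChainComplex.sumIso R M X Y).inv ≫ biprod.snd) n

/-- `fst ∘ inl_* = 𝟙` on `Hₙ(X)` (concrete model). [folklore] -/
@[reassoc (attr := simp)]
lemma map_inl_sumFst (n : ℕ) : map R M (sumInl X Y) n ≫ sumFst n = 𝟙 (csingularHomology R M X n) := by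
  rw [map, sumFst, ← csingularChainComplex.inl_sumIso_hom, ← HomologicalComplex.homologyMap_comp,
    Category.assoc, Iso.hom_inv_id_assoc, biprod.inl_fst, HomologicalComplex.homologyMap_id]

/-- `fst ∘ inr_* = 0` (concrete model). [folklore] -/
@[reassoc (attr := simp)]
lemma map_inr_sumFst (n : ℕ) : map R M (sumInr X Y) n ≫ sumFst n = (0 : csingularHomology R M Y n ⟶ _) := by
  rw [map, sumFst, ← csingularChainComplex.inr_sumIso_hom, ← HomologicalComplex.homologyMap_comp,
    Category.assoc, Iso.hom_inv_id_assoc, biprod.inr_fst, HomologicalComplex.homologyMap_zero]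

/-- `snd ∘ inl_* = 0` (concrete model). [folklore] -/
@[reassoc (attr := simp)]
lemma map_inl_sumSnd (n : ℕ) : map R M (sumInl X Y) n ≫ sumSnd n = (0 : csingularHomology R M X n ⟶ _) := by
  rw [map, sumSnd, ← csingularChainComplex.inl_sumIso_hom, ← HomologicalComplex.homologyMap_comp,
    Category.assoc, Iso.hom_inv_id_assoc, biprod.inl_snd, HomologicalComplex.homologyMap_zero]

/-- `snd ∘ inr_* = 𝟙` on `Hₙ(Y)` (concrete model). [folklore] -/
@[reassoc (attr := simp)]
lemma map_inr_sumSnd (n : ℕ) : map R M (sumInr X Y) n ≫ sumSnd n = 𝟙 (csingularHomology R M Y n) := by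
  rw [map, sumSnd, ← csingularChainComplex.inr_sumIso_hom, ← HomologicalComplex.homologyMap_comp,
    Category.assoc, Iso.hom_inv_id_assoc, biprod.inr_snd, HomologicalComplex.homologyMap_id]

/-- `inl_* ∘ fst + inr_* ∘ snd = 𝟙` on `Hₙ(X ⊕ Y)` (concrete model). [folklore] -/
lemma sumFst_map_inl_add_sumSnd_map_inr (n : ℕ) :
    sumFst n ≫ map R M (sumInl X Y) n + sumSnd n ≫ map R M (sumInr X Y) n =
      𝟙 (csingularHomology R M (X ⊕ Y) n) := by
  have key : ((csingularChainComplex.sumIso R M X Y).inv ≫ biprod.fst) ≫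
      (biprod.inl ≫ (csingularChainComplex.sumIso R M X Y).hom) +
        ((csingularChainComplex.sumIso R M X Y).inv ≫ biprod.snd) ≫
          (biprod.inr ≫ (csingularChainComplex.sumIso R M X Y).hom) = 𝟙 _ := by
    rw [← Category.assoc, ← Category.assoc, ← Preadditive.add_comp, Category.assoc, Category.assoc,
      ← Preadditive.comp_add, biprod.total, Category.comp_id, Iso.inv_hom_id]
  rw [map, map, sumFst, sumSnd, ← csingularChainComplex.inl_sumIso_hom,
    ← csingularChainComplex.inr_sumIso_hom, ← HomologicalComplex.homologyMap_comp,
    ← HomologicalComplex.homologyMap_comp, ← HomologicalComplex.homologyMap_add, key,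
    HomologicalComplex.homologyMap_id]

/-- Every class of `Hₙ(X ⊕ Y)` (concrete model) is `inl_* a + inr_* b`. [folklore] -/
theorem exists_eq_map_inl_add_map_inr (n : ℕ) (z : csingularHomology R M (X ⊕ Y) n) :
    ∃ (a : csingularHomology R M X n) (b : csingularHomology R M Y n),
      map R M (sumInl X Y) n a + map R M (sumInr X Y) n b = z := by
  refine ⟨sumFst n z, sumSnd n z, ?_⟩
  have h := congrArg (fun φ : csingularHomology R M (X ⊕ Y) n ⟶ csingularHomology R M (X ⊕ Y) n => φ z)
    (sumFst_map_inl_add_sumSnd_map_inr (R := R) (M := M) (X := X) (Y := Y) n)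
  simpa only [ModuleCat.hom_add, LinearMap.add_apply, ModuleCat.comp_apply, ModuleCat.id_apply] using h

/-- If `inl_* a + inr_* b = 0` in `Hₙ(X ⊕ Y)` (concrete model) then `a = 0` and `b = 0`. [folklore] -/
theorem eq_zero_of_map_inl_add_map_inr_eq_zero (n : ℕ) (a : csingularHomology R M X n)
    (b : csingularHomology R M Y n)
    (h : map R M (sumInl X Y) n a + map R M (sumInr X Y) n b = 0) : a = 0 ∧ b = 0 := by
  constructor
  · have h1 := congrArg (sumFst (R := R) (M := M) (X := X) (Y := Y) n) h
    rw [map_add, map_zero, ← ModuleCat.comp_apply, ← ModuleCat.comp_apply, map_inl_sumFst,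
      map_inr_sumFst, ModuleCat.id_apply] at h1
    simpa using h1
  · have h2 := congrArg (sumSnd (R := R) (M := M) (X := X) (Y := Y) n) h
    rw [map_add, map_zero, ← ModuleCat.comp_apply, ← ModuleCat.comp_apply, map_inl_sumSnd,
      map_inr_sumSnd, ModuleCat.id_apply] at h2
    simpa using h2

end csingularHomology

namespace singularHomology

open SingularSimplex

variable {R M}

variable (R M X Y) in
/-- The additivity map `Hₙ(X; M) × Hₙ(Y; M) →ₗ[R] Hₙ(X ⊕ Y; M)`, `(a, b) ↦ inl_* a + inr_* b`
(Hatcher 2002, Prop. 2.6). [cite: Hatcher2002, Prop. 2.6] -/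
def sumMap (n : ℕ) :
    (singularHomology R M X n × singularHomology R M Y n) →ₗ[R] singularHomology R M (X ⊕ Y) n :=
  (singularHomology.map R M (sumInl X Y) n).hom.coprod (singularHomology.map R M (sumInr X Y) n).hom

/-- `sumMap (a, b) = inl_* a + inr_* b`. [folklore] -/
@[simp]
lemma sumMap_apply (n : ℕ) (ab : singularHomology R M X n × singularHomology R M Y n) :
    sumMap R M X Y n ab = singularHomology.map R M (sumInl X Y) n ab.1 +
      singularHomology.map R M (sumInr X Y) n ab.2 := rfl

/-- Mathlib's `f_*` in terms of the concrete one: `f_* (comp a) = comp (f_* a)`. [folklore] -/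
lemma map_compIso_hom {Z : Type u} [TopologicalSpace Z] (f : C(X, Z)) (n : ℕ) (a : csingularHomology R M X n) :
    singularHomology.map R M f n ((csingularHomology.compIso R M X n).hom a) =
      (csingularHomology.compIso R M Z n).hom (csingularHomology.map R M f n a) := by
  rw [← ModuleCat.comp_apply, ← csingularHomology.map_comp_compIso_hom, ModuleCat.comp_apply]

/-- **Additivity of singular homology**: `(a, b) ↦ inl_* a + inr_* b` is bijective
(Hatcher 2002, Prop. 2.6: `Hₙ(X) ≅ ⊕_α Hₙ(X_α)` over the path components, in particular for a
disjoint union of two spaces; §2.3, additivity axiom). [cite: Hatcher2002, Prop. 2.6] -/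
theorem sumMap_bijective (n : ℕ) : Function.Bijective (sumMap R M X Y n) := by
  constructor
  · rw [injective_iff_map_eq_zero]
    rintro ⟨a, b⟩ h
    obtain ⟨a', rfl⟩ := (ModuleCat.epi_iff_surjective _).mp
      (inferInstance : Epi (csingularHomology.compIso R M X n).hom) a
    obtain ⟨b', rfl⟩ := (ModuleCat.epi_iff_surjective _).mp
      (inferInstance : Epi (csingularHomology.compIso R M Y n).hom) b
    rw [sumMap_apply, map_compIso_hom, map_compIso_hom, ← map_add] at h
    have h' := congrArg (csingularHomology.compIso R M (X ⊕ Y) n).inv h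
    rw [Iso.hom_inv_id_apply, map_zero] at h'
    obtain ⟨ha, hb⟩ := csingularHomology.eq_zero_of_map_inl_add_map_inr_eq_zero n a' b' h'
    rw [ha, hb, map_zero, map_zero]
    rfl
  · intro z
    obtain ⟨z', rfl⟩ := (ModuleCat.epi_iff_surjective _).mp
      (inferInstance : Epi (csingularHomology.compIso R M (X ⊕ Y) n).hom) z
    obtain ⟨a, b, rfl⟩ := csingularHomology.exists_eq_map_inl_add_map_inr n z'
    refine ⟨((csingularHomology.compIso R M X n).hom a, (csingularHomology.compIso R M Y n).hom b), ?_⟩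
    rw [sumMap_apply, map_compIso_hom, map_compIso_hom, ← map_add]

variable (R M X Y) in
/-- **`Hₙ(X; M) × Hₙ(Y; M) ≃ₗ[R] Hₙ(X ⊕ Y; M)`**, `(a, b) ↦ inl_* a + inr_* b` (Hatcher 2002,
Prop. 2.6; §2.3 axiom (additivity)). [cite: Hatcher2002, Prop. 2.6] -/
def sumEquiv (n : ℕ) :
    (singularHomology R M X n × singularHomology R M Y n) ≃ₗ[R] singularHomology R M (X ⊕ Y) n :=
  LinearEquiv.ofBijective (sumMap R M X Y n) (sumMap_bijective n)

/-- `sumEquiv (a, b) = inl_* a + inr_* b`. [folklore] -/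
@[simp]
lemma sumEquiv_apply (n : ℕ) (ab : singularHomology R M X n × singularHomology R M Y n) :
    sumEquiv R M X Y n ab = singularHomology.map R M (sumInl X Y) n ab.1 +
      singularHomology.map R M (sumInr X Y) n ab.2 := rfl

/-- `inl_* a + inr_* b = 0` iff `a = 0` and `b = 0`. [folklore] -/
theorem map_inl_add_map_inr_eq_zero_iff (n : ℕ) (a : singularHomology R M X n) (b : singularHomology R M Y n) :
    singularHomology.map R M (sumInl X Y) n a + singularHomology.map R M (sumInr X Y) n b = 0 ↔
      a = 0 ∧ b = 0 := by
  change sumEquiv R M X Y n (a, b) = 0 ↔ _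
  rw [LinearEquiv.map_eq_zero_iff, Prod.mk_eq_zero]

/-- `inl_* : Hₙ(X) → Hₙ(X ⊕ Y)` is injective. [folklore] -/
theorem map_inl_injective (n : ℕ) : Function.Injective (singularHomology.map R M (sumInl X Y) n) := by
  rw [injective_iff_map_eq_zero]
  intro a ha
  have h := (map_inl_add_map_inr_eq_zero_iff n a (0 : singularHomology R M Y n)).mp
    (by rw [map_zero, add_zero]; exact ha)
  exact h.1

/-- `inr_* : Hₙ(Y) → Hₙ(X ⊕ Y)` is injective. [folklore] -/
theorem map_inr_injective (n : ℕ) : Function.Injective (singularHomology.map R M (sumInr X Y) n) := by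
  rw [injective_iff_map_eq_zero]
  intro b hb
  have h := (map_inl_add_map_inr_eq_zero_iff n (0 : singularHomology R M X n) b).mp
    (by rw [map_zero, zero_add]; exact hb)
  exact h.2

end singularHomology

/-! ### Additivity of cohomology -/

namespace singularCochainComplex

open SingularSimplex

variable {R M} {n : ℕ}

variable (R M X Y) in
/-- The cochain map `φ ↦ (inl^♯ φ, inr^♯ φ) : C(X ⊕ Y) ⟶ C(X) ⊞ C(Y)` (Hatcher 2002, §3.1, p. 202,
`Hⁿ(∐ X_α; G) ≅ ∏ Hⁿ(X_α; G)`, at cochain level). [cite: Hatcher2002, §3.1 p. 202] -/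
def sumLift : singularCochainComplex R M (X ⊕ Y) ⟶ singularCochainComplex R M X ⊞ singularCochainComplex R M Y :=
  biprod.lift (singularCochainComplex.map R M (sumInl X Y)) (singularCochainComplex.map R M (sumInr X Y))

/-- The first component of `(inl^♯ φ, inr^♯ φ)` is `inl^♯ φ`. [folklore] -/
lemma sumLift_f_fst (φ : (singularCochainComplex R M (X ⊕ Y)).X n) :
    (biprod.fst : singularCochainComplex R M X ⊞ singularCochainComplex R M Y ⟶ _).f n
        ((sumLift R M X Y).f n φ) = (singularCochainComplex.map R M (sumInl X Y)).f n φ := by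
  rw [← ModuleCat.comp_apply, ← HomologicalComplex.comp_f, sumLift, biprod.lift_fst]

/-- The second component of `(inl^♯ φ, inr^♯ φ)` is `inr^♯ φ`. [folklore] -/
lemma sumLift_f_snd (φ : (singularCochainComplex R M (X ⊕ Y)).X n) :
    (biprod.snd : singularCochainComplex R M X ⊞ singularCochainComplex R M Y ⟶ _).f n
        ((sumLift R M X Y).f n φ) = (singularCochainComplex.map R M (sumInr X Y)).f n φ := by
  rw [← ModuleCat.comp_apply, ← HomologicalComplex.comp_f, sumLift, biprod.lift_snd]

/-- A cochain of `X ⊕ Y` is determined by its restrictions to `X` and to `Y`. [folklore] -/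
lemma ext_of_map_inl_inr {φ ψ : (singularCochainComplex R M (X ⊕ Y)).X n}
    (h₁ : (singularCochainComplex.map R M (sumInl X Y)).f n φ = (singularCochainComplex.map R M (sumInl X Y)).f n ψ)
    (h₂ : (singularCochainComplex.map R M (sumInr X Y)).f n φ = (singularCochainComplex.map R M (sumInr X Y)).f n ψ) :
    φ = ψ := by
  refine singularCochainComplex.ext fun σ => ?_
  rcases σ.exists_eq_map_inl_or_inr with ⟨τ, rfl⟩ | ⟨τ, rfl⟩
  · have e := congrFun h₁ τ
    rwa [singularCochainComplex.map_apply, singularCochainComplex.map_apply] at e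
  · have e := congrFun h₂ τ
    rwa [singularCochainComplex.map_apply, singularCochainComplex.map_apply] at e

open scoped Classical in
/-- The cochain of `X ⊕ Y` glued from a cochain of `X` and a cochain of `Y`. [folklore] -/
def glue {N : Type v} (φ₁ : SingularSimplex X n → N) (φ₂ : SingularSimplex Y n → N) :
    SingularSimplex (X ⊕ Y) n → N :=
  fun σ => if h : σ.range ⊆ Set.range Sum.inl then φ₁ (σ.liftInl h)
    else φ₂ (σ.liftInr ((σ.range_subset_inl_or_inr).resolve_left h))

/-- The glued cochain restricts to `φ₁` on `X`. [folklore] -/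
lemma glue_map_inl {N : Type v} (φ₁ : SingularSimplex X n → N) (φ₂ : SingularSimplex Y n → N)
    (τ : SingularSimplex X n) :
    glue φ₁ φ₂ (τ.map (sumInl X Y)) = φ₁ τ := by
  rw [glue, dif_pos (range_map_inl τ), liftInl_map_inl]

/-- The glued cochain restricts to `φ₂` on `Y`. [folklore] -/
lemma glue_map_inr {N : Type v} (φ₁ : SingularSimplex X n → N) (φ₂ : SingularSimplex Y n → N)
    (τ : SingularSimplex Y n) :
    glue φ₁ φ₂ (τ.map (sumInr X Y)) = φ₂ τ := by
  rw [glue, dif_neg (fun h => not_range_subset_inr h (range_map_inr τ)), liftInr_map_inr]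

/-- **`φ ↦ (inl^♯ φ, inr^♯ φ)` is bijective in each degree.** [folklore] -/
theorem sumLift_f_bijective (n : ℕ) : Function.Bijective ((sumLift R M X Y).f n) := by
  constructor
  · intro φ ψ e
    exact ext_of_map_inl_inr
      (by rw [← sumLift_f_fst, ← sumLift_f_fst, e]) (by rw [← sumLift_f_snd, ← sumLift_f_snd, e])
  · intro y
    refine ⟨glue ((biprod.fst : singularCochainComplex R M X ⊞ singularCochainComplex R M Y ⟶ _).f n y)
      ((biprod.snd : singularCochainComplex R M X ⊞ singularCochainComplex R M Y ⟶ _).f n y), ?_⟩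
    have h₁ : (singularCochainComplex.map R M (sumInl X Y)).f n (glue
        ((biprod.fst : singularCochainComplex R M X ⊞ singularCochainComplex R M Y ⟶ _).f n y)
        ((biprod.snd : singularCochainComplex R M X ⊞ singularCochainComplex R M Y ⟶ _).f n y)) =
        (biprod.fst : singularCochainComplex R M X ⊞ singularCochainComplex R M Y ⟶ _).f n y := by
      funext τ
      rw [singularCochainComplex.map_apply, glue_map_inl]
    have h₂ : (singularCochainComplex.map R M (sumInr X Y)).f n (glue
        ((biprod.fst : singularCochainComplex R M X ⊞ singularCochainComplex R M Y ⟶ _).f n y)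
        ((biprod.snd : singularCochainComplex R M X ⊞ singularCochainComplex R M Y ⟶ _).f n y)) =
        (biprod.snd : singularCochainComplex R M X ⊞ singularCochainComplex R M Y ⟶ _).f n y := by
      funext τ
      rw [singularCochainComplex.map_apply, glue_map_inr]
    exact biprodX_ext (by rw [sumLift_f_fst, h₁]) (by rw [sumLift_f_snd, h₂])

/-- **`C(X ⊕ Y) ≅ C(X) ⊞ C(Y)`** as cochain complexes (Hatcher 2002, §3.1, p. 202). [cite: Hatcher2002, §3.1 p. 202] -/
instance isIso_sumLift : IsIso (sumLift R M X Y) := by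
  haveI : ∀ n, IsIso ((sumLift R M X Y).f n) := fun n =>
    (ConcreteCategory.isIso_iff_bijective _).2 (sumLift_f_bijective n)
  exact HomologicalComplex.Hom.isIso_of_components _

variable (R M X Y) in
/-- The isomorphism of cochain complexes `C(X ⊕ Y) ≅ C(X) ⊞ C(Y)`. [folklore] -/
def sumIso : singularCochainComplex R M (X ⊕ Y) ≅ singularCochainComplex R M X ⊞ singularCochainComplex R M Y :=
  asIso (sumLift R M X Y)

/-- `sumIso ≫ fst = inl^♯`. [folklore] -/
@[reassoc (attr := simp)]
lemma sumIso_hom_fst : (sumIso R M X Y).hom ≫ biprod.fst = singularCochainComplex.map R M (sumInl X Y) :=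
  biprod.lift_fst _ _

/-- `sumIso ≫ snd = inr^♯`. [folklore] -/
@[reassoc (attr := simp)]
lemma sumIso_hom_snd : (sumIso R M X Y).hom ≫ biprod.snd = singularCochainComplex.map R M (sumInr X Y) :=
  biprod.lift_snd _ _

end singularCochainComplex

namespace singularCohomology

open SingularSimplex

variable {R M}

/-- The inclusion `Hⁿ(X) → Hⁿ(X ⊕ Y)` of the first factor (through `C(X ⊕ Y) ≅ C(X) ⊞ C(Y)`). [folklore] -/
def sumInlH (n : ℕ) : singularCohomology R M X n ⟶ singularCohomology R M (X ⊕ Y) n :=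
  HomologicalComplex.homologyMap (biprod.inl ≫ (singularCochainComplex.sumIso R M X Y).inv) n

/-- The inclusion `Hⁿ(Y) → Hⁿ(X ⊕ Y)` of the second factor. [folklore] -/
def sumInrH (n : ℕ) : singularCohomology R M Y n ⟶ singularCohomology R M (X ⊕ Y) n :=
  HomologicalComplex.homologyMap (biprod.inr ≫ (singularCochainComplex.sumIso R M X Y).inv) n

/-- `inl^* ∘ inlH = 𝟙` on `Hⁿ(X)`. [folklore] -/
@[reassoc (attr := simp)]
lemma sumInlH_map_inl (n : ℕ) : sumInlH n ≫ map R M (sumInl X Y) n = 𝟙 (singularCohomology R M X n) := by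
  change _ ≫ HomologicalComplex.homologyMap _ n = 𝟙 ((singularCochainComplex R M X).homology n)
  rw [sumInlH, ← singularCochainComplex.sumIso_hom_fst, ← HomologicalComplex.homologyMap_comp,
    Category.assoc, Iso.inv_hom_id_assoc, biprod.inl_fst, HomologicalComplex.homologyMap_id]

/-- `inl^* ∘ inrH = 0`. [folklore] -/
@[reassoc (attr := simp)]
lemma sumInrH_map_inl (n : ℕ) : sumInrH n ≫ map R M (sumInl X Y) n = (0 : singularCohomology R M Y n ⟶ _) := by
  change _ ≫ HomologicalComplex.homologyMap _ n = (0 : (singularCochainComplex R M Y).homology n ⟶ _)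
  rw [sumInrH, ← singularCochainComplex.sumIso_hom_fst, ← HomologicalComplex.homologyMap_comp,
    Category.assoc, Iso.inv_hom_id_assoc, biprod.inr_fst, HomologicalComplex.homologyMap_zero]

/-- `inr^* ∘ inlH = 0`. [folklore] -/
@[reassoc (attr := simp)]
lemma sumInlH_map_inr (n : ℕ) : sumInlH n ≫ map R M (sumInr X Y) n = (0 : singularCohomology R M X n ⟶ _) := by
  change _ ≫ HomologicalComplex.homologyMap _ n = (0 : (singularCochainComplex R M X).homology n ⟶ _)
  rw [sumInlH, ← singularCochainComplex.sumIso_hom_snd, ← HomologicalComplex.homologyMap_comp,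
    Category.assoc, Iso.inv_hom_id_assoc, biprod.inl_snd, HomologicalComplex.homologyMap_zero]

/-- `inr^* ∘ inrH = 𝟙` on `Hⁿ(Y)`. [folklore] -/
@[reassoc (attr := simp)]
lemma sumInrH_map_inr (n : ℕ) : sumInrH n ≫ map R M (sumInr X Y) n = 𝟙 (singularCohomology R M Y n) := by
  change _ ≫ HomologicalComplex.homologyMap _ n = 𝟙 ((singularCochainComplex R M Y).homology n)
  rw [sumInrH, ← singularCochainComplex.sumIso_hom_snd, ← HomologicalComplex.homologyMap_comp,
    Category.assoc, Iso.inv_hom_id_assoc, biprod.inr_snd, HomologicalComplex.homologyMap_id]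

/-- `inl^* ∘ inlH + inr^* ∘ inrH = 𝟙` on `Hⁿ(X ⊕ Y)`. [folklore] -/
lemma map_inl_sumInlH_add_map_inr_sumInrH (n : ℕ) :
    map R M (sumInl X Y) n ≫ sumInlH n + map R M (sumInr X Y) n ≫ sumInrH n =
      𝟙 (singularCohomology R M (X ⊕ Y) n) := by
  have key : ((singularCochainComplex.sumIso R M X Y).hom ≫ biprod.fst) ≫
      (biprod.inl ≫ (singularCochainComplex.sumIso R M X Y).inv) +
        ((singularCochainComplex.sumIso R M X Y).hom ≫ biprod.snd) ≫
          (biprod.inr ≫ (singularCochainComplex.sumIso R M X Y).inv) = 𝟙 _ := by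
    rw [← Category.assoc, ← Category.assoc, ← Preadditive.add_comp, Category.assoc, Category.assoc,
      ← Preadditive.comp_add, biprod.total, Category.comp_id, Iso.hom_inv_id]
  change HomologicalComplex.homologyMap _ n ≫ _ + HomologicalComplex.homologyMap _ n ≫ _ =
    𝟙 ((singularCochainComplex R M (X ⊕ Y)).homology n)
  rw [sumInlH, sumInrH, ← singularCochainComplex.sumIso_hom_fst,
    ← singularCochainComplex.sumIso_hom_snd, ← HomologicalComplex.homologyMap_comp,
    ← HomologicalComplex.homologyMap_comp, ← HomologicalComplex.homologyMap_add, key,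
    HomologicalComplex.homologyMap_id]

variable (R M X Y) in
/-- The additivity map `Hⁿ(X ⊕ Y; M) →ₗ[R] Hⁿ(X; M) × Hⁿ(Y; M)`, `z ↦ (inl^* z, inr^* z)`
(Hatcher 2002, §3.1, p. 202). [cite: Hatcher2002, §3.1 p. 202] -/
def sumMap (n : ℕ) :
    singularCohomology R M (X ⊕ Y) n →ₗ[R] (singularCohomology R M X n × singularCohomology R M Y n) :=
  (singularCohomology.map R M (sumInl X Y) n).hom.prod (singularCohomology.map R M (sumInr X Y) n).hom

/-- `sumMap z = (inl^* z, inr^* z)`. [folklore] -/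
@[simp]
lemma sumMap_apply (n : ℕ) (z : singularCohomology R M (X ⊕ Y) n) :
    sumMap R M X Y n z = (singularCohomology.map R M (sumInl X Y) n z,
      singularCohomology.map R M (sumInr X Y) n z) := rfl

/-- **Additivity of singular cohomology**: `z ↦ (inl^* z, inr^* z)` is bijective
(Hatcher 2002, §3.1, p. 202: `Hⁿ(∐_α X_α; G) ≅ ∏_α Hⁿ(X_α; G)`). [cite: Hatcher2002, §3.1 p. 202] -/
theorem sumMap_bijective (n : ℕ) : Function.Bijective (sumMap R M X Y n) := by
  constructor
  · rw [injective_iff_map_eq_zero]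
    intro z hz
    rw [sumMap_apply, Prod.mk_eq_zero] at hz
    have h := congrArg (fun φ : singularCohomology R M (X ⊕ Y) n ⟶ singularCohomology R M (X ⊕ Y) n => φ z)
      (map_inl_sumInlH_add_map_inr_sumInrH (R := R) (M := M) (X := X) (Y := Y) n)
    simp only [ModuleCat.hom_add, LinearMap.add_apply, ModuleCat.comp_apply, ModuleCat.id_apply] at h
    rw [← h, hz.1, hz.2, map_zero, map_zero, add_zero]
  · rintro ⟨x₁, x₂⟩
    refine ⟨sumInlH n x₁ + sumInrH n x₂, ?_⟩
    rw [sumMap_apply, map_add, map_add, ← ModuleCat.comp_apply, ← ModuleCat.comp_apply,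
      ← ModuleCat.comp_apply, ← ModuleCat.comp_apply, sumInlH_map_inl, sumInrH_map_inl,
      sumInlH_map_inr, sumInrH_map_inr, ModuleCat.id_apply, ModuleCat.id_apply]
    change (x₁ + (0 : singularCohomology R M Y n ⟶ singularCohomology R M X n) x₂,
      (0 : singularCohomology R M X n ⟶ singularCohomology R M Y n) x₁ + x₂) = (x₁, x₂)
    simp

variable (R M X Y) in
/-- **`Hⁿ(X ⊕ Y; M) ≃ₗ[R] Hⁿ(X; M) × Hⁿ(Y; M)`**, `z ↦ (inl^* z, inr^* z)` (Hatcher 2002, §3.1,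
p. 202). [cite: Hatcher2002, §3.1 p. 202] -/
def sumEquiv (n : ℕ) :
    singularCohomology R M (X ⊕ Y) n ≃ₗ[R] (singularCohomology R M X n × singularCohomology R M Y n) :=
  LinearEquiv.ofBijective (sumMap R M X Y n) (sumMap_bijective n)

/-- `sumEquiv z = (inl^* z, inr^* z)`. [folklore] -/
@[simp]
lemma sumEquiv_apply (n : ℕ) (z : singularCohomology R M (X ⊕ Y) n) :
    sumEquiv R M X Y n z = (singularCohomology.map R M (sumInl X Y) n z,
      singularCohomology.map R M (sumInr X Y) n z) := rfl

/-- A class of `Hⁿ(X ⊕ Y)` vanishes iff its restrictions to `X` and `Y` vanish. [folklore] -/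
theorem eq_zero_iff_map_inl_map_inr (n : ℕ) (z : singularCohomology R M (X ⊕ Y) n) :
    z = 0 ↔ singularCohomology.map R M (sumInl X Y) n z = 0 ∧ singularCohomology.map R M (sumInr X Y) n z = 0 := by
  rw [← (sumEquiv R M X Y n).map_eq_zero_iff, sumEquiv_apply, Prod.mk_eq_zero]

/-- Restriction `inl^* : Hⁿ(X ⊕ Y) → Hⁿ(X)` is surjective. [folklore] -/
theorem map_inl_surjective (n : ℕ) : Function.Surjective (singularCohomology.map R M (sumInl X Y) n) := by
  intro x
  obtain ⟨z, hz⟩ := (sumEquiv R M X Y n).surjective (x, 0)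
  rw [sumEquiv_apply, Prod.mk.injEq] at hz
  exact ⟨z, hz.1⟩

/-- Restriction `inr^* : Hⁿ(X ⊕ Y) → Hⁿ(Y)` is surjective. [folklore] -/
theorem map_inr_surjective (n : ℕ) : Function.Surjective (singularCohomology.map R M (sumInr X Y) n) := by
  intro y
  obtain ⟨z, hz⟩ := (sumEquiv R M X Y n).surjective (0, y)
  rw [sumEquiv_apply, Prod.mk.injEq] at hz
  exact ⟨z, hz.2⟩

end singularCohomology

end Literature.AlgebraicTopology.SingularHomology

end
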